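import Literature.Probability.Entropy.FiniteShannon
import Mathlib.Data.Fintype.Prod
import HarnessLib

/-!
# Finite Shannon entropy, II: functional dependence, submodularity, independence, product spaces

Topic `Literature/Probability/Entropy`. Everything in this file is PROVED (no named facts). It
continues `Literature.Probability.Entropy.FiniteShannon` (random variables on a finite weighted
set `(s, w)`, `prob / ent / condEnt / mutualInfo`, chain rule, Jensen) with the further
elementary toolkit consumed by the entropic Ruzsa calculus of
`Literature.Combinatorics.Additive.EntropicRuzsaDistance` (Gowers–Green–Manners–Tao, *On a
conjecture of Marton*, Ann. of Math. 201 (2025), Appendix A) on the way to the polynomial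
Freiman–Ruzsa theorem:

* congruence lemmas (`ent_congr`, `condEnt_congr`, …) and **functional dependence**:
  `ent_pair_eq_of_determines` (`H[X, Y] = H[X]` if `Y` is a function of `X` on `s`),
  `ent_le_ent_of_determines`, `ent_comp_le` (`H[f X] ≤ H[X]`), `ent_eq_of_determines` (mutual
  determination), `condEnt_le_condEnt_of_determines` (conditioning on more information),
  `condEnt_eq_of_determines_left/right`;
* **submodularity** in its usual forms: `condEnt_pair_right_le'` (`H[X | Y, Z] ≤ H[X | Z]`),
  `ent_triple_add_ent_le` (`H[X,Y,Z] + H[Z] ≤ H[X,Z] + H[Y,Z]`), the conditional chain rule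
  `condEnt_pair_eq_add`, and the **conditional mutual information** `condMutualInfo`
  (`I[X : Y | Z] = ∑_z P(Z=z) I[X : Y | Z = z]`) with `condMutualInfo_nonneg`,
  `condMutualInfo_eq` (`= H[X,Z] + H[Y,Z] - H[X,Y,Z] - H[Z]`), `condMutualInfo_eq_condEnt_sub`;
* pushforwards of laws (`prob_comp_eq_sum`), masses of fibres, rescaling of weights;
* **independence** `IndepRV s w X Y` (the joint law is the product of the marginals):
  symmetry, `IndepRV.comp` (functions of independent variables), `IndepRV.ent_pair_eq_add`
  (`H[X, Y] = H[X] + H[Y]`), `IndepRV.condEnt_eq`, `IndepRV.mutualInfo_eq_zero`, the product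
  criterion `indepRV_of_factorizes`, and restriction to rectangles / fibres
  (`IndepRV.filter_pair`, `IndepRV.prob_filter_pair_left/right`, `IndepRV.filter_right`,
  `IndepRV.prob_filter_eq`);
* **product spaces** `(s ×ˢ t, prodW w v)` carrying independent copies: `prob_prod_fst/snd`,
  `indepRV_prod`, `ent_prod_fst/snd`, `condEnt_prod_fst/snd`, `mutualInfo_prod_fst/snd`,
  transport of independence (`IndepRV.prod_fst/snd/mixed`), fibres of products;
* laws on finite types: `ent_eq_sum_univ`, `ent_eq_of_prob_eq` (entropy depends only on the
  law), `prob_univ_id` (the identity on `(univ, μ)` has law `μ`).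

## References
* T. M. Cover, J. A. Thomas, *Elements of Information Theory*, 2nd ed., Wiley 2006, Ch. 2 —
  the standard source of these facts (all folklore).
* W. T. Gowers, B. Green, F. Manners, T. Tao, *On a conjecture of Marton*, Ann. of Math. (2)
  201 (2025), no. 2, Appendix A ((A.1)–(A.9)) — the list of facts actually consumed downstream.

## Design choices
* Same conventions as `FiniteShannon`: weights rather than measures, conditioning is
  `Finset.filter`, all statements for nonnegative weights (`hw`), positive total mass (`hs`)
  where needed; no measurability anywhere.
* Independence is a statement about `prob` only, so it is insensitive to the normalisation of
  the weights and restricts to fibres by the elementary mass computations of this file.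
-/

open Finset Real

noncomputable section

namespace Literature.Probability.Entropy

namespace FiniteShannon

variable {ι κ α β γ δ : Type*}

/-! ### Congruence and functional dependence -/

section Determines

variable [DecidableEq α] [DecidableEq β] [DecidableEq γ] [DecidableEq δ]
  {s : Finset ι} {w : ι → ℝ} {X : ι → α} {Y : ι → β} {Z : ι → γ}

/-- Entropy only depends on the values of the random variable on `s`. [folklore] -/
theorem ent_congr {X X' : ι → α} (h : ∀ i ∈ s, X i = X' i) : ent s w X = ent s w X' := by
  rw [ent_def, ent_def, image_congr h]
  exact sum_congr rfl fun a _ => by rw [prob_congr h]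

/-- Conditional entropy only depends on the values of the random variables on `s`. [folklore] -/
theorem condEnt_congr {X X' : ι → α} {Y Y' : ι → β} (hX : ∀ i ∈ s, X i = X' i)
    (hY : ∀ i ∈ s, Y i = Y' i) : condEnt s w X Y = condEnt s w X' Y' := by
  rw [condEnt_def, condEnt_def, image_congr hY]
  refine sum_congr rfl fun b _ => ?_
  rw [prob_congr hY, filter_congr fun i hi => by rw [hY i hi]]
  congr 1
  exact ent_congr fun i hi => hX i (mem_of_mem_filter i hi)

/-- Mutual information only depends on the values of the random variables on `s`. [folklore] -/
theorem mutualInfo_congr {X X' : ι → α} {Y Y' : ι → β} (hX : ∀ i ∈ s, X i = X' i)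
    (hY : ∀ i ∈ s, Y i = Y' i) : mutualInfo s w X Y = mutualInfo s w X' Y' := by
  rw [mutualInfo_def, mutualInfo_def, ent_congr hX, ent_congr hY,
    ent_congr (X := fun i => (X i, Y i)) (X' := fun i => (X' i, Y' i))
      fun i hi => by rw [hX i hi, hY i hi]]

/-- If `Y` is a function of `X` on `s` (`X i = X j → Y i = Y j`), then `H[X, Y] = H[X]`.
[folklore] -/
theorem ent_pair_eq_of_determines (h : ∀ i ∈ s, ∀ j ∈ s, X i = X j → Y i = Y j) :
    ent s w (fun i => (X i, Y i)) = ent s w X := by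
  classical
  rcases s.eq_empty_or_nonempty with rfl | ⟨i₀, hi₀⟩
  · simp [ent_def]
  · let f : α → β := fun a => if hx : ∃ i ∈ s, X i = a then Y hx.choose else Y i₀
    have hf : ∀ i ∈ s, Y i = f (X i) := by
      intro i hi
      have hx : ∃ j ∈ s, X j = X i := ⟨i, hi, rfl⟩
      simp only [f, dif_pos hx]
      exact h i hi _ hx.choose_spec.1 hx.choose_spec.2.symm
    calc ent s w (fun i => (X i, Y i)) = ent s w (fun i => (X i, f (X i))) :=
          ent_congr fun i hi => by rw [hf i hi]
      _ = ent s w X := ent_pair_apply_eq f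

/-- `H[X] ≤ H[X, Y]`. [folklore] -/
theorem ent_le_ent_pair_left (hw : ∀ i ∈ s, 0 ≤ w i) :
    ent s w X ≤ ent s w (fun i => (X i, Y i)) := by
  rw [← ent_pair_comm, ent_pair_eq_add_condEnt hw]
  linarith [condEnt_nonneg (X := Y) (Y := X) hw]

/-- `H[Y] ≤ H[X, Y]`. [folklore] -/
theorem ent_le_ent_pair_right (hw : ∀ i ∈ s, 0 ≤ w i) :
    ent s w Y ≤ ent s w (fun i => (X i, Y i)) := by
  rw [ent_pair_eq_add_condEnt hw]
  linarith [condEnt_nonneg (X := X) (Y := Y) hw]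

/-- **Functional dependence decreases entropy**: if `Y` is a function of `X` on `s` then
`H[Y] ≤ H[X]`. [folklore] -/
theorem ent_le_ent_of_determines (hw : ∀ i ∈ s, 0 ≤ w i)
    (h : ∀ i ∈ s, ∀ j ∈ s, X i = X j → Y i = Y j) : ent s w Y ≤ ent s w X := by
  rw [← ent_pair_eq_of_determines h]
  exact ent_le_ent_pair_right hw

/-- `H[f(X)] ≤ H[X]`. [folklore] -/
theorem ent_comp_le (hw : ∀ i ∈ s, 0 ≤ w i) (f : α → γ) : ent s w (f ∘ X) ≤ ent s w X :=
  ent_le_ent_of_determines hw fun i _ j _ h => by simp only [Function.comp_apply, h]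

/-- Random variables which determine each other on `s` have the same entropy. [folklore] -/
theorem ent_eq_of_determines (hw : ∀ i ∈ s, 0 ≤ w i)
    (h : ∀ i ∈ s, ∀ j ∈ s, (X i = X j ↔ Y i = Y j)) : ent s w X = ent s w Y :=
  le_antisymm (ent_le_ent_of_determines hw fun i hi j hj => (h i hi j hj).2)
    (ent_le_ent_of_determines hw fun i hi j hj => (h i hi j hj).1)

/-- `H[X | Y] = H[X, Y] - H[Y]`. [folklore] -/
theorem condEnt_eq_ent_pair_sub (hw : ∀ i ∈ s, 0 ≤ w i) :
    condEnt s w X Y = ent s w (fun i => (X i, Y i)) - ent s w Y := by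
  rw [ent_pair_eq_add_condEnt hw]; ring

/-- If `Y` determines `X` on `s` then `H[X | Y] = 0`. [folklore] -/
theorem condEnt_eq_zero_of_determines (hw : ∀ i ∈ s, 0 ≤ w i)
    (h : ∀ i ∈ s, ∀ j ∈ s, Y i = Y j → X i = X j) : condEnt s w X Y = 0 := by
  rw [condEnt_eq_ent_pair_sub hw, ← ent_pair_comm, ent_pair_eq_of_determines h, sub_self]

/-- Conditional entropy is monotone in the information conditioned on: if `Y` determines `Z`
on `s` then `H[X | Y] ≤ H[X | Z]`. [folklore] -/
theorem condEnt_le_condEnt_of_determines (hw : ∀ i ∈ s, 0 ≤ w i)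
    (h : ∀ i ∈ s, ∀ j ∈ s, Y i = Y j → Z i = Z j) : condEnt s w X Y ≤ condEnt s w X Z := by
  -- `H[X | Y] = H[X | Y, Z] ≤ H[X | Z]`
  have h1 : condEnt s w X Y = condEnt s w X (fun i => (Y i, Z i)) := by
    rw [condEnt_eq_ent_pair_sub hw, condEnt_eq_ent_pair_sub hw, ent_pair_eq_of_determines h]
    congr 1
    refine ent_eq_of_determines hw fun i hi j hj => ?_
    simp only [Prod.mk.injEq]
    exact ⟨fun ⟨hx, hy⟩ => ⟨hx, hy, h i hi j hj hy⟩, fun ⟨hx, hy, _⟩ => ⟨hx, hy⟩⟩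
  -- submodularity in the form of `ConditionedProductMarginals.condEnt_pair_right_le`
  have h2 : condEnt s w X (fun i => (Y i, Z i)) ≤ condEnt s w X Z := by
    have e1 := ent_pair_eq_add_condEnt (X := X) (Y := fun i => (Y i, Z i)) hw
    have e2 := ent_pair_eq_add_condEnt (X := Y) (Y := Z) hw
    have e3 := ent_pair_eq_add_condEnt (X := fun i => (X i, Y i)) (Y := Z) hw
    have e4 := condEnt_pair_le_add (X := X) (Y := Y) (Z := Z) hw
    have e5 : ent s w (fun i => (X i, (Y i, Z i))) = ent s w (fun i => ((X i, Y i), Z i)) := by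
      refine ent_eq_of_determines hw fun i _ j _ => ?_
      simp only [Prod.mk.injEq]
      tauto
    have e6 := ent_pair_eq_add_condEnt (X := X) (Y := Z) hw
    linarith
  exact h1.trans_le h2

/-- **Submodularity**: `H[X | Y, Z] ≤ H[X | Z]`. [folklore] -/
theorem condEnt_pair_right_le' (hw : ∀ i ∈ s, 0 ≤ w i) :
    condEnt s w X (fun i => (Y i, Z i)) ≤ condEnt s w X Z :=
  condEnt_le_condEnt_of_determines hw fun i _ j _ h => by
    simp only [Prod.mk.injEq] at h; exact h.2

/-- **Submodularity**, entropy form: `H[X, Y, Z] + H[Z] ≤ H[X, Z] + H[Y, Z]`.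
[folklore] -/
theorem ent_triple_add_ent_le (hw : ∀ i ∈ s, 0 ≤ w i) :
    ent s w (fun i => (X i, Y i, Z i)) + ent s w Z ≤
      ent s w (fun i => (X i, Z i)) + ent s w (fun i => (Y i, Z i)) := by
  have h1 := condEnt_pair_right_le' (X := X) (Y := Y) (Z := Z) hw
  rw [condEnt_eq_ent_pair_sub hw, condEnt_eq_ent_pair_sub hw] at h1
  linarith

/-- Conditional chain rule: `H[X, Y | Z] = H[Y | Z] + H[X | Y, Z]`. [folklore] -/
theorem condEnt_pair_eq_add (hw : ∀ i ∈ s, 0 ≤ w i) :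
    condEnt s w (fun i => (X i, Y i)) Z = condEnt s w Y Z + condEnt s w X (fun i => (Y i, Z i)) := by
  rw [condEnt_eq_ent_pair_sub hw, condEnt_eq_ent_pair_sub hw, condEnt_eq_ent_pair_sub hw]
  have : ent s w (fun i => ((X i, Y i), Z i)) = ent s w (fun i => (X i, (Y i, Z i))) := by
    refine ent_eq_of_determines hw fun i _ j _ => ?_
    simp only [Prod.mk.injEq]
    tauto
  linarith

/-- If `Y` determines `Y'` and `Y'` determines `Y` on `s`, conditioning on either gives the same
conditional entropy. [folklore] -/
theorem condEnt_eq_of_determines_right (hw : ∀ i ∈ s, 0 ≤ w i) {Y' : ι → γ}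
    (h : ∀ i ∈ s, ∀ j ∈ s, (Y i = Y j ↔ Y' i = Y' j)) : condEnt s w X Y = condEnt s w X Y' :=
  le_antisymm (condEnt_le_condEnt_of_determines hw fun i hi j hj => (h i hi j hj).1)
    (condEnt_le_condEnt_of_determines hw fun i hi j hj => (h i hi j hj).2)

/-- If `X` and `X'` determine each other given the conditioning (`Y i = Y j →
(X i = X j ↔ X' i = X' j)`), then `H[X | Y] = H[X' | Y]`. [folklore] -/
theorem condEnt_eq_of_determines_left (hw : ∀ i ∈ s, 0 ≤ w i) {X' : ι → γ}
    (h : ∀ i ∈ s, ∀ j ∈ s, Y i = Y j → (X i = X j ↔ X' i = X' j)) :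
    condEnt s w X Y = condEnt s w X' Y := by
  rw [condEnt_eq_ent_pair_sub hw, condEnt_eq_ent_pair_sub hw]
  congr 1
  refine ent_eq_of_determines hw fun i hi j hj => ?_
  simp only [Prod.mk.injEq]
  constructor
  · rintro ⟨hx, hy⟩; exact ⟨(h i hi j hj hy).1 hx, hy⟩
  · rintro ⟨hx, hy⟩; exact ⟨(h i hi j hj hy).2 hx, hy⟩

/-- `H[X | Y] ≤ H[X]` restated with the pair: `H[X, Y] ≤ H[X] + H[Y]` is `ent_pair_le_add`;
here `H[X, Y] - H[Y] ≤ H[X]`. [folklore] -/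
theorem ent_pair_sub_le (hw : ∀ i ∈ s, 0 ≤ w i) :
    ent s w (fun i => (X i, Y i)) - ent s w Y ≤ ent s w X := by
  linarith [ent_pair_le_add (X := X) (Y := Y) hw]

end Determines

/-! ### Conditional mutual information -/

section CondMutualInfo

variable [DecidableEq α] [DecidableEq β] [DecidableEq γ]
  {s : Finset ι} {w : ι → ℝ} {X : ι → α} {Y : ι → β} {Z : ι → γ}

/-- The **conditional mutual information** `I[X : Y | Z] = ∑_z P(Z = z) I[X : Y | Z = z]`.
[folklore] -/
def condMutualInfo (s : Finset ι) (w : ι → ℝ) (X : ι → α) (Y : ι → β) (Z : ι → γ) : ℝ :=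
  ∑ c ∈ s.image Z, prob s w Z c * mutualInfo (s.filter fun i => Z i = c) w X Y

/-- Unfolding `condMutualInfo`. [folklore] -/
theorem condMutualInfo_def (s : Finset ι) (w : ι → ℝ) (X : ι → α) (Y : ι → β) (Z : ι → γ) :
    condMutualInfo s w X Y Z =
      ∑ c ∈ s.image Z, prob s w Z c * mutualInfo (s.filter fun i => Z i = c) w X Y := rfl

/-- `I[X : Y | Z] ≥ 0`. [folklore] -/
theorem condMutualInfo_nonneg (hw : ∀ i ∈ s, 0 ≤ w i) : 0 ≤ condMutualInfo s w X Y Z :=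
  sum_nonneg fun c _ => mul_nonneg (prob_nonneg hw c)
    (mutualInfo_nonneg fun i hi => hw i (mem_of_mem_filter i hi))

/-- `I[X : Y | Z] = I[Y : X | Z]`. [folklore] -/
theorem condMutualInfo_comm :
    condMutualInfo s w X Y Z = condMutualInfo s w Y X Z := by
  unfold condMutualInfo
  exact sum_congr rfl fun c _ => by rw [mutualInfo_comm]

/-- `I[X : Y | Z] = H[X | Z] + H[Y | Z] - H[X, Y | Z]`. [folklore] -/
theorem condMutualInfo_eq_condEnt :
    condMutualInfo s w X Y Z =
      condEnt s w X Z + condEnt s w Y Z - condEnt s w (fun i => (X i, Y i)) Z := by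
  simp only [condMutualInfo_def, condEnt_def, mutualInfo_def, ← sum_add_distrib, ← sum_sub_distrib]
  exact sum_congr rfl fun c _ => by ring

/-- `I[X : Y | Z] = H[X, Z] + H[Y, Z] - H[X, Y, Z] - H[Z]` (GGMT (A.8)).
[folklore] -/
theorem condMutualInfo_eq (hw : ∀ i ∈ s, 0 ≤ w i) :
    condMutualInfo s w X Y Z = ent s w (fun i => (X i, Z i)) + ent s w (fun i => (Y i, Z i)) -
      ent s w (fun i => (X i, Y i, Z i)) - ent s w Z := by
  rw [condMutualInfo_eq_condEnt, condEnt_eq_ent_pair_sub hw, condEnt_eq_ent_pair_sub hw,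
    condEnt_eq_ent_pair_sub hw]
  have : ent s w (fun i => ((X i, Y i), Z i)) = ent s w (fun i => (X i, Y i, Z i)) := by
    refine ent_eq_of_determines hw fun i _ j _ => ?_
    simp only [Prod.mk.injEq]
    tauto
  linarith

/-- `I[X : Y | Z] = H[X | Z] - H[X | Y, Z]` (GGMT, proof of Prop. 4.1). [folklore] -/
theorem condMutualInfo_eq_condEnt_sub (hw : ∀ i ∈ s, 0 ≤ w i) :
    condMutualInfo s w X Y Z = condEnt s w X Z - condEnt s w X (fun i => (Y i, Z i)) := by
  rw [condMutualInfo_eq_condEnt, condEnt_pair_eq_add hw]; ring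

/-- Conditional mutual information only depends on the values on `s`. [folklore] -/
theorem condMutualInfo_congr {X' : ι → α} {Y' : ι → β} {Z' : ι → γ} (hX : ∀ i ∈ s, X i = X' i)
    (hY : ∀ i ∈ s, Y i = Y' i) (hZ : ∀ i ∈ s, Z i = Z' i) :
    condMutualInfo s w X Y Z = condMutualInfo s w X' Y' Z' := by
  rw [condMutualInfo_eq_condEnt, condMutualInfo_eq_condEnt, condEnt_congr hX hZ,
    condEnt_congr hY hZ, condEnt_congr (X := fun i => (X i, Y i)) (X' := fun i => (X' i, Y' i))
      (fun i hi => by rw [hX i hi, hY i hi]) hZ]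

end CondMutualInfo

/-! ### Pushforwards and masses of fibres -/

section Push

variable [DecidableEq α] [DecidableEq β] [DecidableEq γ] [DecidableEq δ]
  {s : Finset ι} {w : ι → ℝ} {X : ι → α} {Y : ι → β}

/-- `w({X = a}) = P(X = a) · w(s)` (nonnegative weights). [folklore] -/
theorem mass_filter_eq_prob_mul (hw : ∀ i ∈ s, 0 ≤ w i) (X : ι → α) (a : α) :
    mass (s.filter fun i => X i = a) w = prob s w X a * mass s w := by
  rw [prob_def]
  rcases (mass_nonneg hw).eq_or_lt with h0 | hpos
  · rw [← h0, mul_zero]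
    refine le_antisymm ?_ (mass_nonneg fun i hi => hw i (mem_of_mem_filter i hi))
    rw [h0]
    exact mass_filter_le _ hw
  · rw [div_mul_cancel₀ _ hpos.ne']

/-- On a set of total weight zero all probabilities vanish. [folklore] -/
theorem prob_eq_zero_of_mass_eq_zero (h : mass s w = 0) (X : ι → α) (a : α) : prob s w X a = 0 := by
  rw [prob_def, h, div_zero]

/-- Probabilities are invariant under rescaling the weights by a nonzero constant. [folklore] -/
theorem prob_congr_smul_weights {w' : ι → ℝ} {c : ℝ} (h : ∀ i ∈ s, w' i = c * w i) (hc : c ≠ 0)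
    (X : ι → α) (a : α) : prob s w' X a = prob s w X a := by
  have hm : ∀ t ⊆ s, mass t w' = c * mass t w := fun t ht => by
    rw [mass_def, mass_def, mul_sum]
    exact sum_congr rfl fun i hi => h i (ht hi)
  rw [prob_def, prob_def, hm _ (filter_subset _ _), hm _ subset_rfl, mul_div_mul_left _ _ hc]

/-- Entropy is invariant under rescaling the weights by a nonzero constant. [folklore] -/
theorem ent_congr_smul_weights {w' : ι → ℝ} {c : ℝ} (h : ∀ i ∈ s, w' i = c * w i) (hc : c ≠ 0)
    (X : ι → α) : ent s w' X = ent s w X := by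
  rw [ent_def, ent_def]
  exact sum_congr rfl fun a _ => by rw [prob_congr_smul_weights h hc]

/-- `P(f(X) = c, X = a) = 𝟙[f a = c] P(X = a)`. [folklore] -/
theorem prob_comp_pair_eq_ite (f : α → γ) (c : γ) (a : α) :
    prob s w (fun i => (f (X i), X i)) (c, a) = if f a = c then prob s w X a else 0 := by
  unfold prob
  split_ifs with h
  · congr 2
    ext i
    simp only [mem_filter, Prod.mk.injEq, and_congr_right_iff]
    exact fun _ => ⟨fun h' => h'.2, fun h' => ⟨h' ▸ h, h'⟩⟩
  · have : s.filter (fun i => (f (X i), X i) = (c, a)) = ∅ := by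
      rw [filter_eq_empty_iff]
      rintro i - h'
      simp only [Prod.mk.injEq] at h'
      exact h (h'.2 ▸ h'.1)
    rw [this, mass_def, sum_empty, zero_div]

/-- **Pushforward of the law**: `P(f(X) = c) = ∑_{a ∈ t, f a = c} P(X = a)` for any finite
`t ⊇ X(s)`. [folklore] -/
theorem prob_comp_eq_sum (f : α → γ) {t : Finset α} (ht : s.image X ⊆ t) (c : γ) :
    prob s w (f ∘ X) c = ∑ a ∈ t.filter (fun a => f a = c), prob s w X a := by
  rw [sum_filter, prob_eq_sum_prob_pair (X := f ∘ X) (Y := X) (t := t)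
    (fun i hi => ht (mem_image_of_mem X hi))]
  exact sum_congr rfl fun a _ => prob_comp_pair_eq_ite f c a

/-- The law of a pair is supported on the product of the images. [folklore] -/
theorem prob_pair_eq_zero_of_not_mem {a : α} {b : β} (h : a ∉ s.image X ∨ b ∉ s.image Y) :
    prob s w (fun i => (X i, Y i)) (a, b) = 0 := by
  apply prob_eq_zero_of_not_mem_image
  intro hab
  obtain ⟨i, hi, he⟩ := mem_image.1 hab
  simp only [Prod.mk.injEq] at he
  rcases h with h | h
  · exact h (mem_image.2 ⟨i, hi, he.1⟩)
  · exact h (mem_image.2 ⟨i, hi, he.2⟩)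

/-- Marginal of a pair law: `P(X = a) = ∑_{b ∈ t} P(X = a, Y = b)` for `t ⊇ Y(s)`
(restating `prob_eq_sum_prob_pair`). [folklore] -/
theorem prob_eq_sum_prob_pair_left {t : Finset β} (ht : s.image Y ⊆ t) (a : α) :
    prob s w X a = ∑ b ∈ t, prob s w (fun i => (X i, Y i)) (a, b) :=
  prob_eq_sum_prob_pair (fun _ hi => ht (mem_image_of_mem Y hi)) a

/-- Marginal of a pair law on the second coordinate. [folklore] -/
theorem prob_eq_sum_prob_pair_right {t : Finset α} (ht : s.image X ⊆ t) (b : β) :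
    prob s w Y b = ∑ a ∈ t, prob s w (fun i => (X i, Y i)) (a, b) := by
  rw [prob_eq_sum_prob_pair (X := Y) (Y := X) (t := t) (fun i hi => ht (mem_image_of_mem X hi))]
  refine sum_congr rfl fun a _ => ?_
  have : (fun i => (Y i, X i)) = Prod.swap ∘ fun i => (X i, Y i) := rfl
  rw [this, show (b, a) = Prod.swap (a, b) from rfl, prob_comp_of_injective Prod.swap_injective]

end Push

/-! ### Independence -/

section Indep

variable [DecidableEq α] [DecidableEq β] [DecidableEq γ] [DecidableEq δ]
  {s : Finset ι} {w : ι → ℝ} {X : ι → α} {Y : ι → β}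

/-- **Independence** of two random variables on a finite weighted set: the joint law is the
product of the marginals, `P(X = a, Y = b) = P(X = a) P(Y = b)`. [folklore] -/
def IndepRV (s : Finset ι) (w : ι → ℝ) (X : ι → α) (Y : ι → β) : Prop :=
  ∀ a b, prob s w (fun i => (X i, Y i)) (a, b) = prob s w X a * prob s w Y b

/-- Unfolding `IndepRV`. [folklore] -/
theorem indepRV_iff (s : Finset ι) (w : ι → ℝ) (X : ι → α) (Y : ι → β) :
    IndepRV s w X Y ↔
      ∀ a b, prob s w (fun i => (X i, Y i)) (a, b) = prob s w X a * prob s w Y b := Iff.rfl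

/-- Independence is symmetric. [folklore] -/
theorem IndepRV.symm (h : IndepRV s w X Y) : IndepRV s w Y X := by
  intro b a
  have : (fun i => (Y i, X i)) = Prod.swap ∘ fun i => (X i, Y i) := rfl
  rw [this, show (b, a) = Prod.swap (a, b) from rfl, prob_comp_of_injective Prod.swap_injective,
    h a b, mul_comm]

/-- Independence only depends on the values on `s`. [folklore] -/
theorem IndepRV.congr {X' : ι → α} {Y' : ι → β} (h : IndepRV s w X Y) (hX : ∀ i ∈ s, X i = X' i)
    (hY : ∀ i ∈ s, Y i = Y' i) : IndepRV s w X' Y' := by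
  intro a b
  rw [← prob_congr hX, ← prob_congr hY, ← h a b]
  exact prob_congr (fun i hi => by rw [hX i hi, hY i hi]) _

/-- **Functions of independent random variables are independent.** [folklore] -/
theorem IndepRV.comp (h : IndepRV s w X Y) (f : α → γ) (g : β → δ) :
    IndepRV s w (f ∘ X) (g ∘ Y) := by
  intro c d
  have hpair : (fun i => ((f ∘ X) i, (g ∘ Y) i)) = (Prod.map f g) ∘ fun i => (X i, Y i) := rfl
  rw [hpair, prob_comp_eq_sum (Prod.map f g) (image_pair_subset_product (X := X) (Y := Y)) (c, d),
    prob_comp_eq_sum f subset_rfl c, prob_comp_eq_sum g subset_rfl d, sum_mul_sum,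
    ← sum_product', ← filter_product]
  refine sum_congr (filter_congr fun p _ => ?_) fun p _ => h p.1 p.2
  simp only [Prod.map, Prod.mk.injEq]

/-- Independent random variables: `P(X = a, Y ∈ B) = P(X = a) P(Y ∈ B)` in the form
`w({X = a} ∩ {Y = b}) · w(s) = w({X = a}) · w({Y = b})`. [folklore] -/
theorem IndepRV.mass_filter_pair (hw : ∀ i ∈ s, 0 ≤ w i) (h : IndepRV s w X Y) (a : α) (b : β) :
    mass (s.filter fun i => (X i, Y i) = (a, b)) w * mass s w =
      mass (s.filter fun i => X i = a) w * mass (s.filter fun i => Y i = b) w := by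
  rw [mass_filter_eq_prob_mul hw (fun i => (X i, Y i)) (a, b), h a b,
    mass_filter_eq_prob_mul hw X a, mass_filter_eq_prob_mul hw Y b]
  ring

/-- **Entropy of an independent pair**: `H[X, Y] = H[X] + H[Y]` (GGMT (A.4)). [folklore] -/
theorem IndepRV.ent_pair_eq_add (hs : 0 < mass s w)
    (h : IndepRV s w X Y) : ent s w (fun i => (X i, Y i)) = ent s w X + ent s w Y := by
  rw [ent_eq_sum_of_subset (image_pair_subset_product (X := X) (Y := Y)), sum_product]
  have hX1 := sum_prob_eq_one (X := X) hs subset_rfl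
  have hY1 := sum_prob_eq_one (X := Y) hs subset_rfl
  calc ∑ a ∈ s.image X, ∑ b ∈ s.image Y, negMulLog (prob s w (fun i => (X i, Y i)) (a, b))
      = ∑ a ∈ s.image X, ∑ b ∈ s.image Y,
          (prob s w Y b * negMulLog (prob s w X a) + prob s w X a * negMulLog (prob s w Y b)) :=
        sum_congr rfl fun a _ => sum_congr rfl fun b _ => by rw [h a b, negMulLog_mul]
    _ = ∑ a ∈ s.image X, (negMulLog (prob s w X a) + prob s w X a * ent s w Y) := by
        refine sum_congr rfl fun a _ => ?_
        rw [sum_add_distrib, ← sum_mul, ← mul_sum, hY1, one_mul, ent_def]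
    _ = ent s w X + ent s w Y := by
        rw [sum_add_distrib, ← sum_mul, hX1, one_mul, ent_def, ent_def]

/-- For independent `X, Y`: `H[X | Y] = H[X]`. [folklore] -/
theorem IndepRV.condEnt_eq (hw : ∀ i ∈ s, 0 ≤ w i) (hs : 0 < mass s w) (h : IndepRV s w X Y) :
    condEnt s w X Y = ent s w X := by
  rw [condEnt_eq_ent_pair_sub hw, h.ent_pair_eq_add hs, add_sub_cancel_right]

/-- For independent `X, Y`: `I[X : Y] = 0`. [folklore] -/
theorem IndepRV.mutualInfo_eq_zero (hs : 0 < mass s w)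
    (h : IndepRV s w X Y) : mutualInfo s w X Y = 0 := by
  rw [mutualInfo_def, h.ent_pair_eq_add hs, sub_self]

/-- **Product criterion for independence.** If the weights factor as `w i = f(X i) g(Y i)` and
`i ↦ (X i, Y i)` is a bijection from `s` onto `X(s) × Y(s)`, then `X` and `Y` are independent.
[folklore] -/
theorem indepRV_of_factorizes (f : α → ℝ) (g : β → ℝ) (hfac : ∀ i ∈ s, w i = f (X i) * g (Y i))
    (hinj : Set.InjOn (fun i => (X i, Y i)) s)
    (hsurj : ∀ a ∈ s.image X, ∀ b ∈ s.image Y, ∃ i ∈ s, X i = a ∧ Y i = b) :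
    IndepRV s w X Y := by
  -- the image of the pair map is the product of the images
  have himg : s.image (fun i => (X i, Y i)) = s.image X ×ˢ s.image Y := by
    refine Subset.antisymm image_pair_subset_product fun p hp => ?_
    obtain ⟨i, hi, h1, h2⟩ := hsurj p.1 (mem_product.1 hp).1 p.2 (mem_product.1 hp).2
    exact mem_image.2 ⟨i, hi, Prod.ext h1 h2⟩
  -- sums over `s` are sums over the product of the images
  have hsum : ∀ φ : α × β → ℝ, ∑ i ∈ s, φ (X i, Y i) = ∑ p ∈ s.image X ×ˢ s.image Y, φ p := by
    intro φ
    rw [← himg, sum_image fun i hi j hj h => hinj hi hj h]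
  -- masses of fibres
  have hM : mass s w = (∑ a ∈ s.image X, f a) * ∑ b ∈ s.image Y, g b := by
    rw [mass_def, sum_congr rfl hfac, hsum (fun p => f p.1 * g p.2), sum_product, sum_mul_sum]
  have hMX : ∀ a ∈ s.image X, mass (s.filter fun i => X i = a) w = f a * ∑ b ∈ s.image Y, g b := by
    intro a ha
    rw [mass_def, sum_filter, sum_congr rfl fun i hi => show (if X i = a then w i else 0) =
      (fun p : α × β => if p.1 = a then f p.1 * g p.2 else 0) (X i, Y i) by rw [hfac i hi],
      hsum (fun p : α × β => if p.1 = a then f p.1 * g p.2 else 0), sum_product,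
      sum_eq_single_of_mem a ha fun a' _ ha' => by simp [ha'], mul_sum]
    simp
  have hMY : ∀ b ∈ s.image Y, mass (s.filter fun i => Y i = b) w = g b * ∑ a ∈ s.image X, f a := by
    intro b hb
    rw [mass_def, sum_filter, sum_congr rfl fun i hi => show (if Y i = b then w i else 0) =
      (fun p : α × β => if p.2 = b then f p.1 * g p.2 else 0) (X i, Y i) by rw [hfac i hi],
      hsum (fun p : α × β => if p.2 = b then f p.1 * g p.2 else 0), sum_product_right,
      sum_eq_single_of_mem b hb fun b' _ hb' => by simp [hb'], mul_sum]
    simp [mul_comm]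
  have hMXY : ∀ a ∈ s.image X, ∀ b ∈ s.image Y,
      mass (s.filter fun i => (X i, Y i) = (a, b)) w = f a * g b := by
    intro a ha b hb
    rw [mass_def, sum_filter, sum_congr rfl fun i hi => show (if (X i, Y i) = (a, b) then w i else 0)
      = (fun p : α × β => if p = (a, b) then f p.1 * g p.2 else 0) (X i, Y i) by rw [hfac i hi],
      hsum (fun p : α × β => if p = (a, b) then f p.1 * g p.2 else 0),
      sum_eq_single_of_mem (a, b) (mem_product.2 ⟨ha, hb⟩) fun p _ hp => by simp [hp]]
    simp
  intro a b
  by_cases ha : a ∈ s.image X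
  swap
  · rw [prob_pair_eq_zero_of_not_mem (Or.inl ha), prob_eq_zero_of_not_mem_image ha, zero_mul]
  by_cases hb : b ∈ s.image Y
  swap
  · rw [prob_pair_eq_zero_of_not_mem (Or.inr hb), prob_eq_zero_of_not_mem_image hb, mul_zero]
  rw [prob_def, prob_def, prob_def, hMXY a ha b hb, hMX a ha, hMY b hb]
  rcases eq_or_ne (mass s w) 0 with h0 | hne
  · rw [h0]; simp
  · rw [div_mul_div_comm, div_eq_div_iff hne (mul_ne_zero hne hne), hM]
    ring

/-- **Restriction of independence to a rectangle.** If `(X, Z)` and `(Y, W)` are independent,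
then conditionally on `{Z = z, W = w'}` the variables `X` and `Y` are still independent.
[folklore] -/
theorem IndepRV.filter_pair {Z : ι → γ} {W : ι → δ} (hw : ∀ i ∈ s, 0 ≤ w i)
    (h : IndepRV s w (fun i => (X i, Z i)) (fun i => (Y i, W i))) (z : γ) (w' : δ) :
    IndepRV (s.filter fun i => (Z i, W i) = (z, w')) w X Y := by
  set F := s.filter fun i => (Z i, W i) = (z, w') with hF
  have hwF : ∀ i ∈ F, 0 ≤ w i := fun i hi => hw i (mem_of_mem_filter i hi)
  set M := mass s w with hMdef
  -- the four masses, from independence of suitable functions of `(X,Z)` and `(Y,W)`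
  have e1 : ∀ a b, mass (F.filter fun i => (X i, Y i) = (a, b)) w * M =
      mass (s.filter fun i => (X i, Z i) = (a, z)) w * mass (s.filter fun i => (Y i, W i) = (b, w')) w := by
    intro a b
    rw [← h.mass_filter_pair hw (a, z) (b, w'), hF, filter_filter]
    congr 2; ext i; simp only [mem_filter, Prod.mk.injEq]; tauto
  have h2 : IndepRV s w Z W := h.comp Prod.snd Prod.snd
  have h3 : IndepRV s w (fun i => (X i, Z i)) W := h.comp id Prod.snd
  have h4 : IndepRV s w Z (fun i => (Y i, W i)) := h.comp Prod.snd id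
  have e2 : mass F w * M =
      mass (s.filter fun i => Z i = z) w * mass (s.filter fun i => W i = w') w := by
    rw [← h2.mass_filter_pair hw z w', hF]
  have e3 : ∀ a, mass (F.filter fun i => X i = a) w * M =
      mass (s.filter fun i => (X i, Z i) = (a, z)) w * mass (s.filter fun i => W i = w') w := by
    intro a
    rw [← h3.mass_filter_pair hw (a, z) w', hF, filter_filter]
    congr 2; ext i; simp only [mem_filter, Prod.mk.injEq]; tauto
  have e4 : ∀ b, mass (F.filter fun i => Y i = b) w * M =
      mass (s.filter fun i => Z i = z) w * mass (s.filter fun i => (Y i, W i) = (b, w')) w := by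
    intro b
    rw [← h4.mass_filter_pair hw z (b, w'), hF, filter_filter]
    congr 2; ext i; simp only [mem_filter, Prod.mk.injEq]; tauto
  intro a b
  simp only [prob_def]
  rcases eq_or_ne (mass F w) 0 with hF0 | hFne
  · simp [hF0]
  have hMne : M ≠ 0 := by
    intro hM0
    apply hFne
    exact le_antisymm (hM0 ▸ mass_filter_le _ hw) (mass_nonneg hwF)
  rw [div_mul_div_comm, div_eq_div_iff hFne (mul_ne_zero hFne hFne)]
  -- multiply through by `M ^ 2`
  have key : mass (F.filter fun i => (X i, Y i) = (a, b)) w * M * (mass F w * M) * mass F w =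
      mass (F.filter fun i => X i = a) w * M * (mass (F.filter fun i => Y i = b) w * M) * mass F w := by
    rw [e1, e2, e3, e4]; ring
  have hM2 : M * M ≠ 0 := mul_ne_zero hMne hMne
  apply mul_left_cancel₀ hM2
  linear_combination key

/-- On the rectangle `{Z = z, W = w'}` the law of `X` is its law on `{Z = z}`, provided
`(X, Z)` and `W` are independent and `P(W = w') ≠ 0`. [folklore] -/
theorem IndepRV.prob_filter_pair_left {Z : ι → γ} {W : ι → δ} (hw : ∀ i ∈ s, 0 ≤ w i)
    (h : IndepRV s w (fun i => (X i, Z i)) W) (z : γ) {w' : δ} (hw' : prob s w W w' ≠ 0)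
    (a : α) :
    prob (s.filter fun i => (Z i, W i) = (z, w')) w X a = prob (s.filter fun i => Z i = z) w X a := by
  set F := s.filter fun i => (Z i, W i) = (z, w') with hF
  set M := mass s w with hMdef
  have hMne : M ≠ 0 := by
    intro h0; apply hw'; rw [prob_def, ← hMdef, h0, div_zero]
  have hWne : mass (s.filter fun i => W i = w') w ≠ 0 := by
    intro h0; apply hw'; rw [prob_def, h0, zero_div]
  have h2 : IndepRV s w Z W := h.comp Prod.snd id
  have e2 : mass F w * M =
      mass (s.filter fun i => Z i = z) w * mass (s.filter fun i => W i = w') w := by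
    rw [← h2.mass_filter_pair hw z w', hF]
  have e3 : mass (F.filter fun i => X i = a) w * M =
      mass (s.filter fun i => (X i, Z i) = (a, z)) w * mass (s.filter fun i => W i = w') w := by
    rw [← h.mass_filter_pair hw (a, z) w', hF, filter_filter]
    congr 2; ext i; simp only [mem_filter, Prod.mk.injEq]; tauto
  have e5 : (s.filter fun i => Z i = z).filter (fun i => X i = a) =
      s.filter fun i => (X i, Z i) = (a, z) := by
    rw [filter_filter]; ext i; simp only [mem_filter, Prod.mk.injEq]; tauto
  rw [prob_def, prob_def, e5]
  rcases eq_or_ne (mass (s.filter fun i => Z i = z) w) 0 with hZ0 | hZne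
  · -- both sides vanish
    have hF0 : mass F w = 0 := by
      have := e2; rw [hZ0, zero_mul] at this
      exact (mul_eq_zero.1 this).resolve_right hMne
    have hXZ0 : mass (s.filter fun i => (X i, Z i) = (a, z)) w = 0 := by
      refine le_antisymm ?_ (mass_nonneg fun i hi => hw i (mem_of_mem_filter i hi))
      rw [← e5, ← hZ0]
      exact mass_filter_le _ fun i hi => hw i (mem_of_mem_filter i hi)
    rw [hF0, hZ0, div_zero, div_zero]
  have hFne : mass F w ≠ 0 := by
    intro h0; rw [h0, zero_mul] at e2
    exact mul_ne_zero hZne hWne e2.symm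
  rw [div_eq_div_iff hFne hZne]
  apply mul_left_cancel₀ (mul_ne_zero hMne hWne)
  linear_combination (mass (s.filter fun i => W i = w') w * mass (s.filter fun i => Z i = z) w) * e3
    - (mass (s.filter fun i => W i = w') w * mass (s.filter fun i => (X i, Z i) = (a, z)) w) * e2

/-- On the rectangle `{Z = z, W = w'}` the law of `Y` is its law on `{W = w'}`, provided
`Z` and `(Y, W)` are independent and `P(Z = z) ≠ 0`. [folklore] -/
theorem IndepRV.prob_filter_pair_right {Z : ι → γ} {W : ι → δ} (hw : ∀ i ∈ s, 0 ≤ w i)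
    (h : IndepRV s w Z (fun i => (Y i, W i))) {z : γ} (hz : prob s w Z z ≠ 0) (w' : δ)
    (b : β) :
    prob (s.filter fun i => (Z i, W i) = (z, w')) w Y b = prob (s.filter fun i => W i = w') w Y b := by
  rw [← h.symm.prob_filter_pair_left hw w' hz b]
  congr 1
  exact filter_congr fun i _ => by simp only [Prod.mk.injEq]; tauto

/-- If `X` is independent of the pair `(Y, W)`, then conditionally on `{W = w'}` the variables
`X` and `Y` are independent. [folklore] -/
theorem IndepRV.filter_right {W : ι → δ} (hw : ∀ i ∈ s, 0 ≤ w i)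
    (h : IndepRV s w X (fun i => (Y i, W i))) (w' : δ) :
    IndepRV (s.filter fun i => W i = w') w X Y := by
  have h2 : IndepRV s w (fun i => (X i, (0 : ℕ))) (fun i => (Y i, W i)) :=
    h.comp (fun a => (a, (0 : ℕ))) id
  have h3 := h2.filter_pair hw 0 w'
  have : (s.filter fun i => ((0 : ℕ), W i) = (0, w')) = s.filter fun i => W i = w' :=
    filter_congr fun i _ => by simp only [Prod.mk.injEq, true_and]
  rwa [this] at h3

/-- If `X` and `W` are independent then the law of `X` conditionally on `{W = w'}` is the law
of `X` (`P(W = w') ≠ 0`). [folklore] -/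
theorem IndepRV.prob_filter_eq {W : ι → δ} (hw : ∀ i ∈ s, 0 ≤ w i) (h : IndepRV s w X W)
    {w' : δ} (hw' : prob s w W w' ≠ 0) (a : α) :
    prob (s.filter fun i => W i = w') w X a = prob s w X a := by
  have h2 : IndepRV s w (fun i => (X i, (0 : ℕ))) W := h.comp (fun a => (a, (0 : ℕ))) id
  have h3 := h2.prob_filter_pair_left hw 0 hw' a
  have e1 : (s.filter fun i => ((0 : ℕ), W i) = (0, w')) = s.filter fun i => W i = w' :=
    filter_congr fun i _ => by simp only [Prod.mk.injEq, true_and]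
  have e2 : (s.filter fun _ => (0 : ℕ) = 0) = s := filter_true_of_mem fun _ _ => rfl
  rwa [e1, e2] at h3

end Indep

/-! ### Product spaces (independent copies) -/

section ProdSpace

variable [DecidableEq α] [DecidableEq β] {s : Finset ι} {w : ι → ℝ} {t : Finset κ} {v : κ → ℝ}

/-- Product weights `(w ⊗ v)(i, j) = w i · v j` on `s ×ˢ t`: the finite weighted set carrying
independent copies of random variables on `(s, w)` and `(t, v)`. [folklore] -/
def prodW (w : ι → ℝ) (v : κ → ℝ) : ι × κ → ℝ := fun p => w p.1 * v p.2

/-- Unfolding `prodW`. [folklore] -/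
theorem prodW_apply (w : ι → ℝ) (v : κ → ℝ) (p : ι × κ) : prodW w v p = w p.1 * v p.2 := rfl

/-- Product weights are nonnegative. [folklore] -/
theorem prodW_nonneg (hw : ∀ i ∈ s, 0 ≤ w i) (hv : ∀ j ∈ t, 0 ≤ v j) :
    ∀ p ∈ s ×ˢ t, 0 ≤ prodW w v p := fun p hp =>
  mul_nonneg (hw p.1 (mem_product.1 hp).1) (hv p.2 (mem_product.1 hp).2)

/-- `(w ⊗ v)(s' × t') = w(s') v(t')`. [folklore] -/
theorem mass_prod (s' : Finset ι) (t' : Finset κ) :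
    mass (s' ×ˢ t') (prodW w v) = mass s' w * mass t' v := by
  rw [mass_def, sum_product, mass_def, mass_def, sum_mul_sum]
  rfl

/-- A product of sets of positive mass has positive mass. [folklore] -/
theorem mass_prod_pos (hs : 0 < mass s w) (ht : 0 < mass t v) :
    0 < mass (s ×ˢ t) (prodW w v) := by
  rw [mass_prod]; exact mul_pos hs ht

/-- The law of a random variable of the first coordinate on the product space is its law on
the first factor. [folklore] -/
theorem prob_prod_fst (X : ι → α) (ht : mass t v ≠ 0) (a : α) :
    prob (s ×ˢ t) (prodW w v) (fun p => X p.1) a = prob s w X a := by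
  rw [prob_def, prob_def, filter_product_left (fun i => X i = a), mass_prod, mass_prod,
    mul_div_mul_right _ _ ht]

/-- The law of a random variable of the second coordinate on the product space is its law on
the second factor. [folklore] -/
theorem prob_prod_snd (Y : κ → β) (hs : mass s w ≠ 0) (b : β) :
    prob (s ×ˢ t) (prodW w v) (fun p => Y p.2) b = prob t v Y b := by
  rw [prob_def, prob_def, filter_product_right (fun j => Y j = b), mass_prod, mass_prod,
    mul_div_mul_left _ _ hs]

/-- **The two coordinates of the product space are independent.** [folklore] -/
theorem indepRV_prod (X : ι → α) (Y : κ → β) :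
    IndepRV (s ×ˢ t) (prodW w v) (fun p => X p.1) (fun p => Y p.2) := by
  classical
  have h0 : IndepRV (s ×ˢ t) (prodW w v) Prod.fst Prod.snd := by
    refine indepRV_of_factorizes w v (fun p _ => rfl) (fun p _ q _ h => ?_) fun i hi j hj => ?_
    · simpa only [Prod.mk.injEq, Prod.ext_iff] using h
    · obtain ⟨p, hp, rfl⟩ := mem_image.1 hi
      obtain ⟨q, hq, rfl⟩ := mem_image.1 hj
      exact ⟨(p.1, q.2), mem_product.2 ⟨(mem_product.1 hp).1, (mem_product.1 hq).2⟩, rfl, rfl⟩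
  exact h0.comp X Y

/-- Independence on the first factor lifts to the product space. [folklore] -/
theorem IndepRV.prod_fst {X : ι → α} {Y : ι → β} (h : IndepRV s w X Y) (ht : mass t v ≠ 0) :
    IndepRV (s ×ˢ t) (prodW w v) (fun p => X p.1) (fun p => Y p.1) := by
  intro a b
  rw [prob_prod_fst X ht, prob_prod_fst Y ht, ← h a b]
  exact prob_prod_fst (fun i => (X i, Y i)) ht (a, b)

/-- Independence on the second factor lifts to the product space. [folklore] -/
theorem IndepRV.prod_snd {X : κ → α} {Y : κ → β} (h : IndepRV t v X Y) (hs : mass s w ≠ 0) :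
    IndepRV (s ×ˢ t) (prodW w v) (fun p => X p.2) (fun p => Y p.2) := by
  intro a b
  rw [prob_prod_snd X hs, prob_prod_snd Y hs, ← h a b]
  exact prob_prod_snd (fun j => (X j, Y j)) hs (a, b)

/-- A mixed split of the product space: if `Y, Z` are independent on the second factor, then
`(X ∘ fst, Y ∘ snd)` is independent of `Z ∘ snd`. [folklore] -/
theorem IndepRV.prod_mixed {γ' : Type*} [DecidableEq γ'] (X : ι → α) {Y : κ → β} {Z : κ → γ'}
    (h : IndepRV t v Y Z) (hs : mass s w ≠ 0) (ht : mass t v ≠ 0) :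
    IndepRV (s ×ˢ t) (prodW w v) (fun p => (X p.1, Y p.2)) (fun p => Z p.2) := by
  intro ab c
  obtain ⟨a, b⟩ := ab
  have h1 := indepRV_prod (s := s) (w := w) (t := t) (v := v) X (fun j => (Y j, Z j)) a (b, c)
  have h2 := indepRV_prod (s := s) (w := w) (t := t) (v := v) X Y a b
  rw [prob_prod_fst X ht, prob_prod_snd (fun j => (Y j, Z j)) hs] at h1
  rw [prob_prod_fst X ht, prob_prod_snd Y hs] at h2
  rw [prob_prod_snd Z hs, h2, mul_assoc, ← h b c, ← h1]
  have : (fun p : ι × κ => ((X p.1, Y p.2), Z p.2)) =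
      (fun q : α × (β × γ') => ((q.1, q.2.1), q.2.2)) ∘ fun p => (X p.1, (Y p.2, Z p.2)) := rfl
  rw [this, show ((a, b), c) = (fun q : α × (β × γ') => ((q.1, q.2.1), q.2.2)) (a, (b, c)) from rfl,
    prob_comp_of_injective]
  intro q q' hq
  simp only [Prod.mk.injEq] at hq
  exact Prod.ext hq.1.1 (Prod.ext hq.1.2 hq.2)

/-- Entropy of a first-coordinate variable on the product space. [folklore] -/
theorem ent_prod_fst (X : ι → α) (ht : 0 < mass t v) :
    ent (s ×ˢ t) (prodW w v) (fun p => X p.1) = ent s w X := by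
  have hsub : (s ×ˢ t).image (fun p => X p.1) ⊆ s.image X := by
    intro a ha
    obtain ⟨p, hp, rfl⟩ := mem_image.1 ha
    exact mem_image_of_mem X (mem_product.1 hp).1
  rw [ent_eq_sum_of_subset hsub, ent_def]
  exact sum_congr rfl fun a _ => by rw [prob_prod_fst X ht.ne']

/-- Entropy of a second-coordinate variable on the product space. [folklore] -/
theorem ent_prod_snd (Y : κ → β) (hs : 0 < mass s w) :
    ent (s ×ˢ t) (prodW w v) (fun p => Y p.2) = ent t v Y := by
  have hsub : (s ×ˢ t).image (fun p => Y p.2) ⊆ t.image Y := by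
    intro b hb
    obtain ⟨p, hp, rfl⟩ := mem_image.1 hb
    exact mem_image_of_mem Y (mem_product.1 hp).2
  rw [ent_eq_sum_of_subset hsub, ent_def]
  exact sum_congr rfl fun b _ => by rw [prob_prod_snd Y hs.ne']

/-- Conditioning a first-coordinate variable on a first-coordinate variable: the fibre of the
product space is again a product, `{Z ∘ fst = z} = {Z = z} × t`. [folklore] -/
theorem filter_prod_fst {γ' : Type*} [DecidableEq γ'] (Z : ι → γ') (z : γ') :
    (s ×ˢ t).filter (fun p => Z p.1 = z) = s.filter (fun i => Z i = z) ×ˢ t :=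
  filter_product_left (fun i => Z i = z)

/-- `{W ∘ snd = w'} = s × {W = w'}`. [folklore] -/
theorem filter_prod_snd {γ' : Type*} [DecidableEq γ'] (W : κ → γ') (z : γ') :
    (s ×ˢ t).filter (fun p => W p.2 = z) = s ×ˢ t.filter (fun j => W j = z) :=
  filter_product_right (fun j => W j = z)

/-- `{Z ∘ fst = z, W ∘ snd = w'} = {Z = z} × {W = w'}`. [folklore] -/
theorem filter_prod_pair {γ' δ' : Type*} [DecidableEq γ'] [DecidableEq δ'] (Z : ι → γ')
    (W : κ → δ') (z : γ') (w' : δ') :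
    (s ×ˢ t).filter (fun p => (Z p.1, W p.2) = (z, w')) =
      s.filter (fun i => Z i = z) ×ˢ t.filter (fun j => W j = w') := by
  rw [← filter_product]
  exact filter_congr fun p _ => by simp only [Prod.mk.injEq]

/-- Conditional entropy of first-coordinate variables on the product space. [folklore] -/
theorem condEnt_prod_fst {γ' : Type*} [DecidableEq γ'] (X : ι → α) (Z : ι → γ')
    (ht : 0 < mass t v) :
    condEnt (s ×ˢ t) (prodW w v) (fun p => X p.1) (fun p => Z p.1) = condEnt s w X Z := by
  have hsub : (s ×ˢ t).image (fun p => Z p.1) ⊆ s.image Z := by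
    intro a ha
    obtain ⟨p, hp, rfl⟩ := mem_image.1 ha
    exact mem_image_of_mem Z (mem_product.1 hp).1
  rw [condEnt_eq_sum_of_subset hsub, condEnt_def]
  refine sum_congr rfl fun z _ => ?_
  rw [prob_prod_fst Z ht.ne', filter_prod_fst, ent_prod_fst X ht]

/-- Conditional entropy of second-coordinate variables on the product space. [folklore] -/
theorem condEnt_prod_snd {γ' : Type*} [DecidableEq γ'] (Y : κ → β) (W : κ → γ')
    (hs : 0 < mass s w) :
    condEnt (s ×ˢ t) (prodW w v) (fun p => Y p.2) (fun p => W p.2) = condEnt t v Y W := by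
  have hsub : (s ×ˢ t).image (fun p => W p.2) ⊆ t.image W := by
    intro a ha
    obtain ⟨p, hp, rfl⟩ := mem_image.1 ha
    exact mem_image_of_mem W (mem_product.1 hp).2
  rw [condEnt_eq_sum_of_subset hsub, condEnt_def]
  refine sum_congr rfl fun z _ => ?_
  rw [prob_prod_snd W hs.ne', filter_prod_snd, ent_prod_snd Y hs]

/-- Mutual information of first-coordinate variables on the product space. [folklore] -/
theorem mutualInfo_prod_fst {γ' : Type*} [DecidableEq γ'] (X : ι → α) (Z : ι → γ')
    (ht : 0 < mass t v) :
    mutualInfo (s ×ˢ t) (prodW w v) (fun p => X p.1) (fun p => Z p.1) = mutualInfo s w X Z := by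
  rw [mutualInfo_def, mutualInfo_def, ent_prod_fst X ht, ent_prod_fst Z ht]
  exact congrArg _ (ent_prod_fst (fun i => (X i, Z i)) ht)

/-- Mutual information of second-coordinate variables on the product space. [folklore] -/
theorem mutualInfo_prod_snd {γ' : Type*} [DecidableEq γ'] (Y : κ → β) (W : κ → γ')
    (hs : 0 < mass s w) :
    mutualInfo (s ×ˢ t) (prodW w v) (fun p => Y p.2) (fun p => W p.2) = mutualInfo t v Y W := by
  rw [mutualInfo_def, mutualInfo_def, ent_prod_snd Y hs, ent_prod_snd W hs]
  exact congrArg _ (ent_prod_snd (fun j => (Y j, W j)) hs)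

end ProdSpace

/-! ### Laws on finite types -/

section FintypeLaw

variable [Fintype α] [DecidableEq α] [DecidableEq β] {s : Finset ι} {w : ι → ℝ} {X : ι → α}

/-- For a finite value type the entropy is the sum over all values. [folklore] -/
theorem ent_eq_sum_univ (s : Finset ι) (w : ι → ℝ) (X : ι → α) :
    ent s w X = ∑ a, negMulLog (prob s w X a) :=
  ent_eq_sum_of_subset (subset_univ _)

/-- For a finite value type the law sums to one (positive mass). [folklore] -/
theorem sum_univ_prob_eq_one (hs : 0 < mass s w) (X : ι → α) : ∑ a, prob s w X a = 1 :=
  sum_prob_eq_one hs (subset_univ _)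

/-- For a finite conditioning type the conditional entropy is the sum over all values.
[folklore] -/
theorem condEnt_eq_sum_univ (s : Finset ι) (w : ι → ℝ) (Y : ι → β) (X : ι → α) :
    condEnt s w Y X = ∑ a, prob s w X a * ent (s.filter fun i => X i = a) w Y :=
  condEnt_eq_sum_of_subset (subset_univ _)

/-- Two random variables (on possibly different finite weighted sets) with the same law have
the same entropy. [folklore] -/
theorem ent_eq_of_prob_eq {κ' : Type*} {t : Finset κ'} {v : κ' → ℝ} {Y : κ' → α}
    (h : ∀ a, prob s w X a = prob t v Y a) : ent s w X = ent t v Y := by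
  rw [ent_eq_sum_univ, ent_eq_sum_univ]
  exact Fintype.sum_congr _ _ fun a => by rw [h a]

/-- The canonical realisation of a law `μ` on a finite type: the identity random variable on
`(univ, μ)` has law `μ` when `∑ μ = 1`. [folklore] -/
theorem prob_univ_id {μ : α → ℝ} (hμ : ∑ a, μ a = 1) (a : α) :
    prob (univ : Finset α) μ id a = μ a := by
  have : (univ : Finset α).filter (fun i => id i = a) = {a} := by ext; simp
  rw [prob_def, mass_def, mass_def, hμ, div_one, this, sum_singleton]

end FintypeLaw

end FiniteShannon

end Literature.Probability.Entropy

end
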